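import Mathlib
import Literature.Analysis.FluidPDE.SuitableWeak
import Literature.Analysis.FluidPDE.CKNVelocityIntegrability
import Literature.Analysis.FluidPDE.LocalLerayCubicIntegrability
import Literature.Analysis.FluidPDE.LerayHopfProofs
import Literature.Analysis.FluidPDE.Seregin2023.TypeIIEulerZoomScenario
import HarnessLib

/-!
# Local bounds of Seregin's power-gauged Euler class on the slab `(−∞,0) × ℝ³`
# (route №10 `EulerZoomLiouville`, support item Z = stmt-NavierStokesRegularity-19834, piece (e), part 1)

Helper file (theorems only; `--supports stmt-NavierStokesRegularity-19834`). Seat ns-typeII-p3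
(cell ns-regularity-ideate §B, D-0081; DIRECTOR-NS g6 #3: the Summits-side half of Z).

The named fact `Seregin2023.seregin2026_typeII_scenario_eulerLimit` (Seregin, arXiv:2606.29468,
Thm 3.1) delivers its Euler limit `(u, p)` with a weak spatial gradient `Gu` and the weighted bound
(3.5) `A_F(u, a) + D_F(p, a) + E_F(Gu, a) ≤ c` for all `a > 0` (tree `weightedA` — an ESSENTIAL
supremum in time —, `weightedD`, `weightedE`, with the power weight `F(a) = a^ρ`).  The route decl
`EulerZoomLiouville.SereginZoomReduction` wants a member of the CKN class `IsSuitableWeakSolutionOn`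
on the slab.  This file extracts from (3.5) the LOCAL bounds that class needs:
* `exists_subset_parabolicCylinder_of_isCompact` — a compact subset of the open slab lies in some
  parabolic cylinder `Q_a(0) = ]−a², 0[ × B_a`;
* `ae_ball_energy_le_of_weightedA` — `∫_{B_a} |u(t)|² ≤ c a^{1−2ρ}` for a.e. `t ∈ ]−a², 0[`, and its
  indicator form `energy_indicator_le_of_weightedA` (the shape of the `L^∞_t L²_x` clause and of the
  tree's interpolation lemma `lintegral_rpow_ten_thirds_lt_top_of_energy`);
* `lintegral_cylinder_pressure_lt_top_of_weightedD`, `lintegral_cylinder_grad_lt_top_of_weightedE` —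
  `p ∈ L^{3/2}(Q_a)`, `Gu ∈ L²(Q_a)`;
* `lintegral_cylinder_ten_thirds_lt_top`, `lintegral_cylinder_cube_lt_top` — `u ∈ L^{10/3}(Q_a)`
  (Lemarié-Rieusset 2016 (13.18), the tree's interpolation) hence `|u|³ ∈ L¹(Q_a)`
  (`x³ ≤ 1 + x^{10/3}`, tree `IsLocalLeraySolution.pow_three_le_one_add_rpow`), the integrability that turns Seregin's sliced local energy inequality (3.7)
  into the integrated CKN form (sequel file).
WHAT THIS IS NOT: not NS regularity and not Seregin's compactness theorem — bookkeeping for a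
reduction modulo the typed printed fact. [folklore]
-/

noncomputable section

-- the summit and its single problem share the name `NavierStokesRegularity` (D-0017 nested layout)
set_option linter.dupNamespace false

open Set Function Filter Topology MeasureTheory Metric TopologicalSpace
open scoped NNReal ENNReal InnerProductSpace RealInnerProductSpace

namespace Summit.NavierStokesRegularity.NavierStokesRegularity.Theorems.SereginZoomReduction

open Literature.Analysis Literature.Analysis.FluidPDE Literature.Analysis.FluidPDE.Seregin2023

/-! ## Compact subsets of the slab lie in parabolic cylinders -/

/-- **A compact subset of the open slab `(−∞,0) × ℝ³` lies in some parabolic cylinder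
`Q_a(0) = ]−a², 0[ × B_a(0)`.** [folklore] -/
theorem exists_subset_parabolicCylinder_of_isCompact {K : Set (ℝ × EuclideanSpace ℝ (Fin 3))}
    (hK : IsCompact K) (hKs : K ⊆ Iio (0 : ℝ) ×ˢ (univ : Set (EuclideanSpace ℝ (Fin 3)))) :
    ∃ a : ℝ, 0 < a ∧ K ⊆ parabolicCylinder a (0 : ℝ × EuclideanSpace ℝ (Fin 3)) := by
  -- a bound on the norms
  obtain ⟨R, hR⟩ := (hK.isBounded.subset_closedBall (0 : ℝ × EuclideanSpace ℝ (Fin 3)))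
  -- the largest time in `K` is negative
  by_cases hne : K.Nonempty
  · obtain ⟨z₀, hz₀, hmax⟩ := hK.exists_isMaxOn hne continuous_fst.continuousOn
    have hz₀t : z₀.1 < 0 := (mem_prod.1 (hKs hz₀)).1
    refine ⟨max R 0 + 1, by positivity, fun z hz => ?_⟩
    have hzR : ‖z‖ ≤ R := by simpa using hR hz
    have h1 : |z.1| ≤ R := (norm_fst_le z).trans hzR
    have h2 : ‖z.2‖ ≤ R := (norm_snd_le z).trans hzR
    unfold parabolicCylinder
    refine ⟨⟨?_, ?_⟩, ?_⟩
    · have : -R ≤ z.1 := (abs_le.1 h1).1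
      simp only [Prod.fst_zero]
      nlinarith [le_max_left R 0, le_max_right R 0]
    · exact (hmax hz).trans_lt hz₀t
    · rw [mem_ball, Prod.snd_zero, dist_zero_right]
      linarith [le_max_left R 0]
  · refine ⟨1, one_pos, fun z hz => (hne ⟨z, hz⟩).elim⟩

/-! ## The energy bound from `A_F` -/

/-- **Slice energies from the weighted bound `A_F ≤ c`** (`F(a) = a^ρ`): for a.e. `t ∈ ]−a², 0[`,
`∫_{B_a} |u(t)|² ≤ c · a / (a^ρ)²` (unwinding the essential supremum). [folklore] -/
theorem ae_ball_energy_le_of_weightedA {ρ a : ℝ} (ha : 0 < a) {c : ℝ≥0}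
    {u : ℝ → EuclideanSpace ℝ (Fin 3) → EuclideanSpace ℝ (Fin 3)}
    (hA : weightedA (fun r => r ^ ρ) a (0 : ℝ × EuclideanSpace ℝ (Fin 3)) u ≤ (c : ℝ≥0∞)) :
    ∀ᵐ t ∂(volume.restrict (Ioo (-(a ^ 2)) 0)),
      ∫⁻ x in ball (0 : EuclideanSpace ℝ (Fin 3)) a, ‖u t x‖ₑ ^ 2 ≤
        ENNReal.ofReal ((c : ℝ) * (a / (a ^ ρ) ^ 2)) := by
  have hw : 0 < (a ^ ρ) ^ 2 / a := by positivity
  have h1 : ∀ᵐ t ∂(volume.restrict (Ioo ((0 : ℝ × EuclideanSpace ℝ (Fin 3)).1 - a ^ 2)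
      (0 : ℝ × EuclideanSpace ℝ (Fin 3)).1)),
      ENNReal.ofReal ((a ^ ρ) ^ 2 / a) * ∫⁻ x in ball (0 : ℝ × EuclideanSpace ℝ (Fin 3)).2 a, ‖u t x‖ₑ ^ 2 ≤
        (c : ℝ≥0∞) :=
    (ae_le_essSup).mono fun t ht => ht.trans hA
  have hset : Ioo ((0 : ℝ × EuclideanSpace ℝ (Fin 3)).1 - a ^ 2) (0 : ℝ × EuclideanSpace ℝ (Fin 3)).1 =
      Ioo (-(a ^ 2)) 0 := by simp
  rw [hset] at h1
  filter_upwards [h1] with t ht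
  have h2 : ∫⁻ x in ball (0 : EuclideanSpace ℝ (Fin 3)) a, ‖u t x‖ₑ ^ 2 ≤
      (c : ℝ≥0∞) / ENNReal.ofReal ((a ^ ρ) ^ 2 / a) := by
    rw [ENNReal.le_div_iff_mul_le (Or.inl (ENNReal.ofReal_pos.2 hw).ne') (Or.inl ENNReal.ofReal_ne_top),
      mul_comm]
    exact ht
  refine h2.trans (le_of_eq ?_)
  rw [← ENNReal.ofReal_coe_nnreal, ← ENNReal.ofReal_div_of_pos hw]
  congr 1
  field_simp

/-- **The `L^∞_t L²_x` bound in indicator form**: with `A_F(u, a) ≤ c` at the origin there is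
`C` with `∫ 1_{Q_a(0)} |u|²(t, ·) ≤ C` for a.e. `t` (the shape used by `IsSuitableWeakSolutionOn` and
by the tree's `lintegral_rpow_ten_thirds_lt_top_of_energy`). [folklore] -/
theorem energy_indicator_le_of_weightedA {ρ a : ℝ} (ha : 0 < a) {c : ℝ≥0}
    {u : ℝ → EuclideanSpace ℝ (Fin 3) → EuclideanSpace ℝ (Fin 3)}
    (hA : weightedA (fun r => r ^ ρ) a (0 : ℝ × EuclideanSpace ℝ (Fin 3)) u ≤ (c : ℝ≥0∞)) :
    ∃ C : ℝ≥0, ∀ᵐ t : ℝ, ∫⁻ x, (parabolicCylinder a (0 : ℝ × EuclideanSpace ℝ (Fin 3))).indicator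
      (fun z : ℝ × EuclideanSpace ℝ (Fin 3) => ‖u z.1 z.2‖ₑ ^ 2) (t, x) ≤ C := by
  refine ⟨((c : ℝ) * (a / (a ^ ρ) ^ 2)).toNNReal, ?_⟩
  have h1 := ae_ball_energy_le_of_weightedA ha hA
  rw [ae_restrict_iff' measurableSet_Ioo] at h1
  filter_upwards [h1] with t ht
  by_cases hmem : t ∈ Ioo (-(a ^ 2)) 0
  · have hind : ∀ x, (parabolicCylinder a (0 : ℝ × EuclideanSpace ℝ (Fin 3))).indicator
        (fun z : ℝ × EuclideanSpace ℝ (Fin 3) => ‖u z.1 z.2‖ₑ ^ 2) (t, x) =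
        (ball (0 : EuclideanSpace ℝ (Fin 3)) a).indicator (fun x => ‖u t x‖ₑ ^ 2) x := by
      intro x
      unfold parabolicCylinder
      by_cases hx : x ∈ ball (0 : EuclideanSpace ℝ (Fin 3)) a
      · rw [indicator_of_mem (mem_prod.2 ⟨by simpa using hmem, hx⟩), indicator_of_mem hx]
      · rw [indicator_of_notMem (fun h => hx (mem_prod.1 h).2), indicator_of_notMem hx]
    simp_rw [hind]
    rw [lintegral_indicator measurableSet_ball]
    refine (ht hmem).trans (le_of_eq ?_)
    rw [ENNReal.ofReal, ENNReal.coe_inj]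
  · have hind : ∀ x, (parabolicCylinder a (0 : ℝ × EuclideanSpace ℝ (Fin 3))).indicator
        (fun z : ℝ × EuclideanSpace ℝ (Fin 3) => ‖u z.1 z.2‖ₑ ^ 2) (t, x) = 0 := by
      intro x
      unfold parabolicCylinder
      exact indicator_of_notMem (fun h => hmem (by simpa using (mem_prod.1 h).1)) _
    simp_rw [hind]
    simp

/-! ## Pressure and gradient from `D_F`, `E_F` -/

/-- **`p ∈ L^{3/2}(Q_a)` from `D_F(p, a) ≤ c`** (`F(a) = a^ρ`, `a > 0`). [folklore] -/
theorem lintegral_cylinder_pressure_lt_top_of_weightedD {ρ a : ℝ} (ha : 0 < a) {c : ℝ≥0}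
    {p : ℝ → EuclideanSpace ℝ (Fin 3) → ℝ}
    (hD : weightedD (fun r => r ^ ρ) a (0 : ℝ × EuclideanSpace ℝ (Fin 3)) p ≤ (c : ℝ≥0∞)) :
    ∫⁻ w in parabolicCylinder a (0 : ℝ × EuclideanSpace ℝ (Fin 3)), ‖p w.1 w.2‖ₑ ^ (3 / 2 : ℝ) < ⊤ := by
  have hw : 0 < (a ^ ρ) ^ 2 / a ^ 2 := by positivity
  unfold weightedD at hD
  have h1 : ∫⁻ w in parabolicCylinder a (0 : ℝ × EuclideanSpace ℝ (Fin 3)), ‖p w.1 w.2‖ₑ ^ (3 / 2 : ℝ) ≤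
      (c : ℝ≥0∞) / ENNReal.ofReal ((a ^ ρ) ^ 2 / a ^ 2) := by
    rw [ENNReal.le_div_iff_mul_le (Or.inl (ENNReal.ofReal_pos.2 hw).ne') (Or.inl ENNReal.ofReal_ne_top),
      mul_comm]
    exact hD
  exact lt_of_le_of_lt h1 (ENNReal.div_lt_top ENNReal.coe_ne_top (ENNReal.ofReal_pos.2 hw).ne')

/-- **`Gu ∈ L²(Q_a)` from `E_F(Gu, a) ≤ c`** (`F(a) = a^ρ`, `a > 0`). [folklore] -/
theorem lintegral_cylinder_grad_lt_top_of_weightedE {ρ a : ℝ} (ha : 0 < a) {c : ℝ≥0}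
    {G : ℝ → EuclideanSpace ℝ (Fin 3) → EuclideanSpace ℝ (Fin 3) →L[ℝ] EuclideanSpace ℝ (Fin 3)}
    (hE : weightedE (fun r => r ^ ρ) a (0 : ℝ × EuclideanSpace ℝ (Fin 3)) G ≤ (c : ℝ≥0∞)) :
    ∫⁻ w in parabolicCylinder a (0 : ℝ × EuclideanSpace ℝ (Fin 3)),
      ENNReal.ofReal (frobeniusNormSq (G w.1 w.2)) < ⊤ := by
  have hw : 0 < a ^ ρ / a := by positivity
  unfold weightedE at hE
  have h1 : ∫⁻ w in parabolicCylinder a (0 : ℝ × EuclideanSpace ℝ (Fin 3)),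
      ENNReal.ofReal (frobeniusNormSq (G w.1 w.2)) ≤ (c : ℝ≥0∞) / ENNReal.ofReal (a ^ ρ / a) := by
    rw [ENNReal.le_div_iff_mul_le (Or.inl (ENNReal.ofReal_pos.2 hw).ne') (Or.inl ENNReal.ofReal_ne_top),
      mul_comm]
    exact hE
  exact lt_of_le_of_lt h1 (ENNReal.div_lt_top ENNReal.coe_ne_top (ENNReal.ofReal_pos.2 hw).ne')

/-! ## `u ∈ L^{10/3}(Q_a)` and `|u|³ ∈ L¹(Q_a)` -/

/-- **`u ∈ L^{10/3}(Q_a(0))`** for a field with the weighted bounds `A_F(u,a) ≤ c`, `E_F(Gu,a) ≤ c`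
and weak spatial gradient `Gu` on the slab (the tree's interpolation
`lintegral_rpow_ten_thirds_lt_top_of_energy`, Lemarié-Rieusset 2016 (13.18), on
`Ω = Q_a(0)`). [cite: LemarieRieusset2016, (13.18) p. 461] -/
theorem lintegral_cylinder_ten_thirds_lt_top {ρ a : ℝ} (ha : 0 < a) {c : ℝ≥0}
    {u : ℝ → EuclideanSpace ℝ (Fin 3) → EuclideanSpace ℝ (Fin 3)}
    {G : ℝ → EuclideanSpace ℝ (Fin 3) → EuclideanSpace ℝ (Fin 3) →L[ℝ] EuclideanSpace ℝ (Fin 3)}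
    (hG : HasWeakSpatialGradientOn (slab (EuclideanSpace ℝ (Fin 3)) (Iio 0) isOpen_Iio) u G)
    (hA : weightedA (fun r => r ^ ρ) a (0 : ℝ × EuclideanSpace ℝ (Fin 3)) u ≤ (c : ℝ≥0∞))
    (hE : weightedE (fun r => r ^ ρ) a (0 : ℝ × EuclideanSpace ℝ (Fin 3)) G ≤ (c : ℝ≥0∞)) :
    ∫⁻ w in parabolicCylinder a (0 : ℝ × EuclideanSpace ℝ (Fin 3)), ‖u w.1 w.2‖ₑ ^ (10 / 3 : ℝ) < ⊤ := by
  have hle : parabolicCylinderOpens a (0 : ℝ × EuclideanSpace ℝ (Fin 3)) ≤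
      slab (EuclideanSpace ℝ (Fin 3)) (Iio 0) isOpen_Iio := by
    intro z hz
    rw [mem_slab]
    have hz' : z ∈ parabolicCylinder a (0 : ℝ × EuclideanSpace ℝ (Fin 3)) := hz
    unfold parabolicCylinder at hz'
    exact (mem_prod.1 hz').1.2
  have hG' := hG.mono hle
  have hEn := energy_indicator_le_of_weightedA ha hA
  have hGsq : ∫⁻ z in (parabolicCylinderOpens a (0 : ℝ × EuclideanSpace ℝ (Fin 3)) :
      Set (ℝ × EuclideanSpace ℝ (Fin 3))), ENNReal.ofReal (frobeniusNormSq (G z.1 z.2)) < ⊤ := by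
    rw [coe_parabolicCylinderOpens]
    exact lintegral_cylinder_grad_lt_top_of_weightedE ha hE
  have hsub : Ioo ((0 : ℝ × EuclideanSpace ℝ (Fin 3)).1 - a ^ 2) (0 : ℝ × EuclideanSpace ℝ (Fin 3)).1 ×ˢ
      ball (0 : ℝ × EuclideanSpace ℝ (Fin 3)).2 a ⊆
      (parabolicCylinderOpens a (0 : ℝ × EuclideanSpace ℝ (Fin 3)) : Set (ℝ × EuclideanSpace ℝ (Fin 3))) :=
    fun z hz => hz
  have hEn' : ∃ C : ℝ≥0, ∀ᵐ t : ℝ, ∫⁻ x, ((parabolicCylinderOpens a (0 : ℝ × EuclideanSpace ℝ (Fin 3)) :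
      Set (ℝ × EuclideanSpace ℝ (Fin 3)))).indicator
      (fun z : ℝ × EuclideanSpace ℝ (Fin 3) => ‖u z.1 z.2‖ₑ ^ 2) (t, x) ≤ C := by
    rw [coe_parabolicCylinderOpens]
    exact hEn
  have h := lintegral_rpow_ten_thirds_lt_top_of_energy finrank_euclideanSpace_fin hEn' hG' hGsq hsub
  exact h

/-- **`|u|³ ∈ L¹(Q_a(0))`** under the weighted bounds `A_F ≤ c`, `E_F ≤ c` (from `L^{10/3}` and
`x³ ≤ 1 + x^{10/3}` on the finite-measure cylinder). [folklore] -/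
theorem lintegral_cylinder_cube_lt_top {ρ a : ℝ} (ha : 0 < a) {c : ℝ≥0}
    {u : ℝ → EuclideanSpace ℝ (Fin 3) → EuclideanSpace ℝ (Fin 3)}
    {G : ℝ → EuclideanSpace ℝ (Fin 3) → EuclideanSpace ℝ (Fin 3) →L[ℝ] EuclideanSpace ℝ (Fin 3)}
    (hG : HasWeakSpatialGradientOn (slab (EuclideanSpace ℝ (Fin 3)) (Iio 0) isOpen_Iio) u G)
    (hA : weightedA (fun r => r ^ ρ) a (0 : ℝ × EuclideanSpace ℝ (Fin 3)) u ≤ (c : ℝ≥0∞))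
    (hE : weightedE (fun r => r ^ ρ) a (0 : ℝ × EuclideanSpace ℝ (Fin 3)) G ≤ (c : ℝ≥0∞)) :
    ∫⁻ w in parabolicCylinder a (0 : ℝ × EuclideanSpace ℝ (Fin 3)), ‖u w.1 w.2‖ₑ ^ (3 : ℕ) < ⊤ := by
  have h1 := lintegral_cylinder_ten_thirds_lt_top ha hG hA hE
  have hfin : volume (parabolicCylinder a (0 : ℝ × EuclideanSpace ℝ (Fin 3))) < ⊤ := by
    unfold parabolicCylinder
    rw [Measure.volume_eq_prod, Measure.prod_prod]
    exact ENNReal.mul_lt_top measure_Ioo_lt_top measure_ball_lt_top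
  calc ∫⁻ w in parabolicCylinder a (0 : ℝ × EuclideanSpace ℝ (Fin 3)), ‖u w.1 w.2‖ₑ ^ (3 : ℕ)
      ≤ ∫⁻ w in parabolicCylinder a (0 : ℝ × EuclideanSpace ℝ (Fin 3)), (1 + ‖u w.1 w.2‖ₑ ^ (10 / 3 : ℝ)) :=
        lintegral_mono fun w => IsLocalLeraySolution.pow_three_le_one_add_rpow _
    _ = volume (parabolicCylinder a (0 : ℝ × EuclideanSpace ℝ (Fin 3))) +
          ∫⁻ w in parabolicCylinder a (0 : ℝ × EuclideanSpace ℝ (Fin 3)), ‖u w.1 w.2‖ₑ ^ (10 / 3 : ℝ) := by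
        rw [lintegral_add_left' aemeasurable_const, lintegral_const, Measure.restrict_apply_univ, one_mul]
    _ < ⊤ := ENNReal.add_lt_top.2 ⟨hfin, h1⟩

/-! ## The three local clauses of the CKN class -/

/-- **The `L^∞_t L²_x`-class clause of `IsSuitableWeakSolutionOn` on the slab** from the weighted
bound `A_F(u, a) ≤ c` for all `a > 0`. [folklore] -/
theorem energyClass_of_weightedA {ρ : ℝ} {c : ℝ≥0}
    {u : ℝ → EuclideanSpace ℝ (Fin 3) → EuclideanSpace ℝ (Fin 3)}
    (hA : ∀ a : ℝ, 0 < a → weightedA (fun r => r ^ ρ) a (0 : ℝ × EuclideanSpace ℝ (Fin 3)) u ≤ (c : ℝ≥0∞)) :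
    ∀ K ⊆ ((slab (EuclideanSpace ℝ (Fin 3)) (Iio 0) isOpen_Iio : Opens (ℝ × EuclideanSpace ℝ (Fin 3))) :
        Set (ℝ × EuclideanSpace ℝ (Fin 3))), IsCompact K → ∃ C : ℝ≥0, ∀ᵐ t : ℝ,
      ∫⁻ x, K.indicator (fun z : ℝ × EuclideanSpace ℝ (Fin 3) => ‖u z.1 z.2‖ₑ ^ 2) (t, x) ≤ C := by
  intro K hKs hK
  rw [coe_slab] at hKs
  obtain ⟨a, ha, hKa⟩ := exists_subset_parabolicCylinder_of_isCompact hK hKs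
  obtain ⟨C, hC⟩ := energy_indicator_le_of_weightedA ha (hA a ha)
  refine ⟨C, ?_⟩
  filter_upwards [hC] with t ht
  refine le_trans (lintegral_mono fun x => ?_) ht
  exact indicator_le_indicator_of_subset hKa (fun _ => zero_le) _

/-- **The pressure clause `p ∈ L^{3/2}_loc` of `IsSuitableWeakSolutionOn` on the slab** from
`D_F(p, a) ≤ c` for all `a > 0`. [folklore] -/
theorem pressureClass_of_weightedD {ρ : ℝ} {c : ℝ≥0} {p : ℝ → EuclideanSpace ℝ (Fin 3) → ℝ}
    (hD : ∀ a : ℝ, 0 < a → weightedD (fun r => r ^ ρ) a (0 : ℝ × EuclideanSpace ℝ (Fin 3)) p ≤ (c : ℝ≥0∞)) :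
    ∀ K ⊆ ((slab (EuclideanSpace ℝ (Fin 3)) (Iio 0) isOpen_Iio : Opens (ℝ × EuclideanSpace ℝ (Fin 3))) :
        Set (ℝ × EuclideanSpace ℝ (Fin 3))), IsCompact K →
      ∫⁻ z in K, ‖p z.1 z.2‖ₑ ^ (3 / 2 : ℝ) < ⊤ := by
  intro K hKs hK
  rw [coe_slab] at hKs
  obtain ⟨a, ha, hKa⟩ := exists_subset_parabolicCylinder_of_isCompact hK hKs
  exact lt_of_le_of_lt (lintegral_mono_set hKa) (lintegral_cylinder_pressure_lt_top_of_weightedD ha (hD a ha))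

/-- **The gradient clause `Gu ∈ L²_loc` of `IsSuitableWeakSolutionOn` on the slab** from
`E_F(Gu, a) ≤ c` for all `a > 0`. [folklore] -/
theorem gradClass_of_weightedE {ρ : ℝ} {c : ℝ≥0}
    {G : ℝ → EuclideanSpace ℝ (Fin 3) → EuclideanSpace ℝ (Fin 3) →L[ℝ] EuclideanSpace ℝ (Fin 3)}
    (hE : ∀ a : ℝ, 0 < a → weightedE (fun r => r ^ ρ) a (0 : ℝ × EuclideanSpace ℝ (Fin 3)) G ≤ (c : ℝ≥0∞)) :
    ∀ K ⊆ ((slab (EuclideanSpace ℝ (Fin 3)) (Iio 0) isOpen_Iio : Opens (ℝ × EuclideanSpace ℝ (Fin 3))) :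
        Set (ℝ × EuclideanSpace ℝ (Fin 3))), IsCompact K →
      ∫⁻ z in K, ENNReal.ofReal (frobeniusNormSq (G z.1 z.2)) < ⊤ := by
  intro K hKs hK
  rw [coe_slab] at hKs
  obtain ⟨a, ha, hKa⟩ := exists_subset_parabolicCylinder_of_isCompact hK hKs
  exact lt_of_le_of_lt (lintegral_mono_set hKa) (lintegral_cylinder_grad_lt_top_of_weightedE ha (hE a ha))

end Summit.NavierStokesRegularity.NavierStokesRegularity.Theorems.SereginZoomReduction

end
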